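import Literature.Algebra.Homology.TensorObjFinrank
import HarnessLib

/-!
# Multiplicativity of the Euler characteristic: `χ(C ⊗ D) = χ(C)·χ(D)`

Layer `Literature/Algebra/Homology` (pure linear algebra over Mathlib; proved theorems only, 0 definitions, 0 named
facts, no instances, no notation). FILE 2 of 2 (FILE 1 = `TensorObjFinrank`). For bounded cochain complexes `C`, `D` of
finite-dimensional vector spaces over a field `k` (`Cⁱ = 0` off `Finset.Icc a₁ b₁`, `Dʲ = 0` off `Finset.Icc a₂ b₂`;
Mathlib's monoidal structure `HomologicalComplex.tensorObj C D` on `CochainComplex (ModuleCat k) ℤ`) and Mathlib's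
`HomologicalComplex.eulerChar` ∕ `homologyEulerChar`:

* `finrankSupport_subset_Icc` — the rank support of a complex vanishing off `Icc a b` lies in `Icc a b`;
* `sum_negOnePow_mul_sum_filter_eq` — the Cauchy-product rearrangement
  `Σ_{n ∈ Icc (a₁+a₂) (b₁+b₂)} (−1)ⁿ Σ_{(i,j) ∈ box, i+j=n} cᵢ dⱼ = (Σ_{i ∈ Icc a₁ b₁} (−1)ⁱ cᵢ)(Σ_{j ∈ Icc a₂ b₂} (−1)ʲ dⱼ)`
  (`Finset.sum_fiberwise_of_maps_to`, `Finset.sum_product`, `Finset.sum_mul_sum`, `Int.negOnePow_add`);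
* **`eulerChar_tensorObj : (C ⊗ D).eulerChar = C.eulerChar * D.eulerChar`** (FILE 1's `finrank_tensorObj_X` +
  row `EulerPoincareFormula`'s `Finset` form);
* **`homologyEulerChar_tensorObj : (C ⊗ D).homologyEulerChar = C.homologyEulerChar * D.homologyEulerChar`** (the
  Euler–Poincaré formula `EulerPoincare.eulerChar_eq_homologyEulerChar` on the three complexes — no Künneth formula is
  needed for the numerical statement).

Mathlib (pin v4.32) has no tensor-product lemma for its `eulerChar` (`lean search 'eulerChar'`: the defining file only).
Library only (cell `pub-hodge-ring2`, count-neutral); proves nothing about any crux, route or conjecture.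

## References

* S. Lang, *Algebra* (2002), Ch. XX §3 (Euler characteristic), Ch. XVI §2. [Lang2002]
* C. A. Weibel, *An introduction to homological algebra* (1994), 2.7.1, Thm. 3.6.3. [Weibel1994]
-/

open CategoryTheory CategoryTheory.Limits

universe u

namespace Literature.Algebra.Homology.EulerCharTensor

/-! ### Bookkeeping -/

/-- The rank support of a `ℤ`-graded object of `ModuleCat` vanishing off `Icc a b` lies in `Icc a b`. [cite: Lang2002, XX §3] -/
theorem finrankSupport_subset_Icc {k : Type u} [Field k] (X : GradedObject ℤ (ModuleCat.{u} k)) (a b : ℤ)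
    (hX : ∀ i, i ∉ Finset.Icc a b → IsZero (X i)) :
    GradedObject.finrankSupport X ⊆ (Finset.Icc a b : Finset ℤ) := by
  intro i hi
  by_contra hi'
  haveI := ModuleCat.subsingleton_of_isZero (hX i hi')
  exact hi Module.finrank_zero_of_subsingleton

/-- **Cauchy-product rearrangement with signs**:
`Σ_{n ∈ Icc (a₁+a₂) (b₁+b₂)} (−1)ⁿ Σ_{(i,j) ∈ Icc a₁ b₁ ×ˢ Icc a₂ b₂, i+j=n} f i · g j = (Σ_i (−1)ⁱ f i)(Σ_j (−1)ʲ g j)`.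
[cite: Lang2002, XX §3] -/
theorem sum_negOnePow_mul_sum_filter_eq (a₁ b₁ a₂ b₂ : ℤ) (f g : ℤ → ℤ) :
    ∑ n ∈ Finset.Icc (a₁ + a₂) (b₁ + b₂), (n.negOnePow : ℤ) *
        ∑ p ∈ (Finset.Icc a₁ b₁ ×ˢ Finset.Icc a₂ b₂).filter (fun p : ℤ × ℤ => p.1 + p.2 = n), f p.1 * g p.2 =
      (∑ i ∈ Finset.Icc a₁ b₁, (i.negOnePow : ℤ) * f i) * ∑ j ∈ Finset.Icc a₂ b₂, (j.negOnePow : ℤ) * g j := by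
  have hmaps : ∀ p ∈ Finset.Icc a₁ b₁ ×ˢ Finset.Icc a₂ b₂, p.1 + p.2 ∈ Finset.Icc (a₁ + a₂) (b₁ + b₂) := by
    intro p hp
    simp only [Finset.mem_product, Finset.mem_Icc] at hp ⊢
    omega
  calc ∑ n ∈ Finset.Icc (a₁ + a₂) (b₁ + b₂), (n.negOnePow : ℤ) *
        ∑ p ∈ (Finset.Icc a₁ b₁ ×ˢ Finset.Icc a₂ b₂).filter (fun p : ℤ × ℤ => p.1 + p.2 = n), f p.1 * g p.2
      = ∑ n ∈ Finset.Icc (a₁ + a₂) (b₁ + b₂),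
          ∑ p ∈ (Finset.Icc a₁ b₁ ×ˢ Finset.Icc a₂ b₂).filter (fun p : ℤ × ℤ => p.1 + p.2 = n),
            ((p.1 + p.2).negOnePow : ℤ) * (f p.1 * g p.2) := by
        refine Finset.sum_congr rfl fun n _ => ?_
        rw [Finset.mul_sum]
        refine Finset.sum_congr rfl fun p hp => ?_
        rw [(Finset.mem_filter.1 hp).2]
    _ = ∑ p ∈ Finset.Icc a₁ b₁ ×ˢ Finset.Icc a₂ b₂, ((p.1 + p.2).negOnePow : ℤ) * (f p.1 * g p.2) :=
        Finset.sum_fiberwise_of_maps_to hmaps _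
    _ = ∑ i ∈ Finset.Icc a₁ b₁, ∑ j ∈ Finset.Icc a₂ b₂, ((i.negOnePow : ℤ) * f i) * ((j.negOnePow : ℤ) * g j) := by
        rw [Finset.sum_product]
        refine Finset.sum_congr rfl fun i _ => Finset.sum_congr rfl fun j _ => ?_
        rw [Int.negOnePow_add, Units.val_mul]
        ring
    _ = (∑ i ∈ Finset.Icc a₁ b₁, (i.negOnePow : ℤ) * f i) * ∑ j ∈ Finset.Icc a₂ b₂, (j.negOnePow : ℤ) * g j := by
        rw [Finset.sum_mul_sum]

/-! ### `χ(C ⊗ D) = χ(C)·χ(D)` -/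

variable {k : Type u} [Field k] (C D : CochainComplex (ModuleCat.{u} k) ℤ) (a₁ b₁ a₂ b₂ : ℤ)
  (hC : ∀ i, i ∉ Finset.Icc a₁ b₁ → IsZero (C.X i)) (hD : ∀ j, j ∉ Finset.Icc a₂ b₂ → IsZero (D.X j))
  [∀ i, Module.Finite k (C.X i)] [∀ j, Module.Finite k (D.X j)]

include hC hD in
/-- **`χ(C ⊗ D) = χ(C)·χ(D)`** for Mathlib's `HomologicalComplex.eulerChar`, for bounded cochain complexes of
finite-dimensional vector spaces over a field. [cite: Lang2002, XX §3] [cite: Weibel1994, 2.7.1] -/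
theorem eulerChar_tensorObj :
    (HomologicalComplex.tensorObj C D).eulerChar = C.eulerChar * D.eulerChar := by
  rw [(HomologicalComplex.tensorObj C D).eulerChar_eq_sum_finSet_of_finrankSupport_subset _
      (TensorObjFinrank.finrankSupport_tensorObj_subset C D a₁ b₁ a₂ b₂ hC hD),
    C.eulerChar_eq_sum_finSet_of_finrankSupport_subset _ (finrankSupport_subset_Icc C.X a₁ b₁ hC),
    D.eulerChar_eq_sum_finSet_of_finrankSupport_subset _ (finrankSupport_subset_Icc D.X a₂ b₂ hD)]
  simp only [ComplexShape.χ, ComplexShape.eulerCharSignsUpInt_χ,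
    TensorObjFinrank.finrank_tensorObj_X C D a₁ b₁ a₂ b₂ hC hD, Nat.cast_sum, Nat.cast_mul]
  exact sum_negOnePow_mul_sum_filter_eq a₁ b₁ a₂ b₂ (fun i => (Module.finrank k (C.X i) : ℤ))
    (fun j => (Module.finrank k (D.X j) : ℤ))

include hC hD in
/-- **`χ_H(C ⊗ D) = χ_H(C)·χ_H(D)`** for Mathlib's `HomologicalComplex.homologyEulerChar`, for bounded cochain complexes of
finite-dimensional vector spaces over a field (Euler–Poincaré on `C`, `D`, `C ⊗ D`). [cite: Lang2002, XX §3 Thm. 3.1] -/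
theorem homologyEulerChar_tensorObj :
    (HomologicalComplex.tensorObj C D).homologyEulerChar = C.homologyEulerChar * D.homologyEulerChar := by
  haveI := fun n => TensorObjFinrank.moduleFinite_tensorObj_X C D a₁ b₁ a₂ b₂ hC hD n
  rw [← EulerPoincare.eulerChar_eq_homologyEulerChar _ ((Finset.finite_toSet _).subset
        (TensorObjFinrank.finrankSupport_tensorObj_subset C D a₁ b₁ a₂ b₂ hC hD)),
    ← EulerPoincare.eulerChar_eq_homologyEulerChar _ ((Finset.finite_toSet _).subset
        (finrankSupport_subset_Icc C.X a₁ b₁ hC)),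
    ← EulerPoincare.eulerChar_eq_homologyEulerChar _ ((Finset.finite_toSet _).subset
        (finrankSupport_subset_Icc D.X a₂ b₂ hD))]
  exact eulerChar_tensorObj C D a₁ b₁ a₂ b₂ hC hD

end Literature.Algebra.Homology.EulerCharTensor
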